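import Mathlib
import Summits.ResolutionOfSingularities.ResolutionOfSingularities.Theorems.HomologicalConductorPersistenceCyclicQuotientCompletionSatFour
import Summits.ResolutionOfSingularities.ResolutionOfSingularities.Theorems.HomologicalConductorPersistenceCyclicQuotientLocalVertex
import Summits.ResolutionOfSingularities.ResolutionOfSingularities.Theorems.HomologicalConductorPersistenceCompletionIsolatedTransfer
import Literature.RingTheory.CohomologyAnnihilator.AnnihilationOfCohomologyProofs
import Literature.RingTheory.CohomologyAnnihilator.Localization
import HarnessLib

/-!
# Rung S-2 `PersistenceSurface` (stmt-ResolutionOfSingularities-19970), stub C1 (`Sat₄`) — `Sat₄` AT EVERY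
# ANALYTICALLY-TORIC SURFACE STAGE, HYPOTHESIS-MINIMAL FORM

[OURS · cell decomp-res · rung S-2; seat leafhand-res-homologicalconduct-17 gen 0]  Nothing here is a statement of the
manuscript under review (Hironaka 2017); AI-written, weaker than expert review.  DEF-FREE.

The capstone `…CyclicQuotientCompletionSatFour.cohomologyAnnihilator_le_caAt_four_of_ringEquiv_completion_vertex` (this
seat) carries three side hypotheses: `Ŝ` is an isolated singularity (`S` = `U = k[u,v]^{(n;1,q)}` localised at its vertex),
`T̂` is an isolated singularity, and `dim T = 2`.  All three are DISCHARGED here: (i) `S` is an isolated singularity —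
`uⁿ/1, vⁿ/1 ∈ ca³(S)` and a prime of `S` containing both contracts to the vertex ([IyengarTakahashi2014, Lemma 2.10 (2)]:
a prime not containing `ca³` is a regular point); (ii) `U` is a finitely generated `k`-algebra (Artin–Tate on
`k ⊆ U ⊆ k[u,v]`, `k[u,v]` integral over `U`), so `Ŝ` is an isolated singularity (`…CompletionIsolatedTransfer`, EGA IV₂
7.8.3 (v) through the tree's excellence library); (iii) isolated singularities transport along ring isomorphisms, so
`T̂ ≃+* Ŝ` makes `T̂` one; (iv) `dim T = dim T̂ = dim Ŝ = dim S = 2`.  Net statement: **for every noetherian local ring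
`T` whose completion is a domain ring-isomorphic to `Ŝ`, `caᵐ(T) = ca(T)` for all `m ≥ 4`** — the only remaining side
hypothesis is «`T̂` (equivalently `Ŝ`) is a domain» (analytic irreducibility; used for the reflexivity of second
syzygies over `Ŝ` in `…CompleteHerzogTransfer`).

* `isIsolatedSingularity_atVertex` — (i);
* `finiteType_degreeZero_and_finite` — `U` is of finite type over `k` (Artin–Tate), `k[u,v]` module-finite over `U`;
* `isIsolatedSingularity_adicCompletion_atVertex` — (ii);
* `isIsolatedSingularity_of_ringEquiv` — (iii);
* `ringKrullDim_eq_two_of_ringEquiv_completion_vertex` — (iv);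
* `cohomologyAnnihilator_le_caAt_four_of_ringEquiv_completion_vertex'`,
  `cohomologyAnnihilatorOfDegree_eq_of_ringEquiv_completion_vertex'` — **`Sat₄` at every analytically-toric surface
  stage, hypotheses: `T` noetherian local, `T̂` a domain, `e : T̂ ≃+* Ŝ`.**

References: S. B. Iyengar, R. Takahashi, IMRN 2016, Lemma 2.10 (2) [`IyengarTakahashi2014`]; H. Matsumura,
*Commutative Ring Theory*, §32 [`Matsumura1987`]; M. Atiyah, I. Macdonald, Prop. 7.8 (Artin–Tate) — tree/Mathlib lemmas.
-/

-- single-problem summit: the doubled namespace component `ResolutionOfSingularities` is forced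
set_option linter.dupNamespace false

noncomputable section

open IsLocalRing MvPolynomial Literature.RingTheory.CohomologyAnnihilator
open Literature.AlgebraicGeometry.Resolution (ringKrullDim_adicCompletion)
open Summit.ResolutionOfSingularities.ResolutionOfSingularities.Theorems.HomologicalConductor
open Summit.ResolutionOfSingularities.ResolutionOfSingularities.Theorems.HomologicalConductor.PersistenceCyclicQuotientCharFree
  (isNoetherianRing_degreeZero)
open Summit.ResolutionOfSingularities.ResolutionOfSingularities.Theorems.HomologicalConductor.PersistenceCyclicQuotientVertexIsolated
  (X_pow_mem X_zero_pow_mem_caAt_three X_one_pow_mem_caAt_three mem_of_constantCoeff_eq_zero)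
open Summit.ResolutionOfSingularities.ResolutionOfSingularities.Theorems.HomologicalConductor.PersistenceCyclicQuotientLocalVertex
  (isIntegral_degreeZero)
open Summit.ResolutionOfSingularities.ResolutionOfSingularities.Theorems.HomologicalConductor.PersistenceCyclicQuotientVertexDimension
  (ringKrullDim_atVertex)
open Summit.ResolutionOfSingularities.ResolutionOfSingularities.Theorems.HomologicalConductor.PersistenceSurfaceSaturationCommonCompletion
  (constantCoeff_eq_zero_of_mem_vertex cohomologyAnnihilator_le_caAt_of_levelled_of_ringEquiv_completion)
open Summit.ResolutionOfSingularities.ResolutionOfSingularities.Theorems.HomologicalConductor.PersistenceCyclicQuotientCompletionSatFour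
  (levelledSatFour_adicCompletion_atVertex)

universe u

namespace Summit.ResolutionOfSingularities.ResolutionOfSingularities.Theorems.HomologicalConductor.PersistenceCyclicQuotientCompletionSatFourMinimal

/-! ## Isolated singularities transport along ring isomorphisms -/

/-- **Isolated singularities transport along ring isomorphisms**: primes `𝔮 ≠ 𝔪_B` of `B` contract along
`e : A ≃+* B` to primes `≠ 𝔪_A`, and `A_{e⁻¹𝔮} ≃+* B_𝔮`. [folklore] -/
theorem isIsolatedSingularity_of_ringEquiv {A B : Type u} [CommRing A] [CommRing B] [IsLocalRing A] [IsLocalRing B]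
    (e : A ≃+* B) (h : IsIsolatedSingularity A) : IsIsolatedSingularity B := by
  intro 𝔮 _ hne
  have hne' : 𝔮.comap e ≠ maximalIdeal A := by
    intro heq
    apply hne
    rw [← Ideal.map_comap_of_surjective e e.surjective 𝔮, heq]
    exact map_ringEquiv_maximalIdeal e
  haveI := h (𝔮.comap e) hne'
  exact IsRegularLocalRing.of_ringEquiv <| IsLocalization.ringEquivOfRingEquiv
    (Localization.AtPrime (𝔮.comap e)) (Localization.AtPrime 𝔮) e (e.map_primeCompl_comap_eq 𝔮)

/-! ## The localisation of `U` at the vertex is an isolated singularity -/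

variable {k : Type u} [Field k] {n : ℕ} [NeZero n] {q : ℕ} (U : Subalgebra k (MvPolynomial (Fin 2) k))
variable (hU : ∀ p, p ∈ U ↔ weightedHomogeneousComponent (![1, (q : ZMod n)] : Fin 2 → ZMod n) 0 p = p)

include hU in
/-- **A prime of `U` containing `uⁿ` and `vⁿ` is the vertex** (it contains every invariant of zero constant term,
`…VertexIsolated.mem_of_constantCoeff_eq_zero`, hence the maximal `𝔪`). [folklore] -/
theorem eq_vertex_of_X_pow_mem (𝔪 : Ideal U) [𝔪.IsMaximal]
    (hu : (⟨(X 0 : MvPolynomial (Fin 2) k) ^ n, X_pow_mem U hU 0⟩ : U) ∈ 𝔪)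
    (hv : (⟨(X 1 : MvPolynomial (Fin 2) k) ^ n, X_pow_mem U hU 1⟩ : U) ∈ 𝔪) (𝔭 : Ideal U) [𝔭.IsPrime]
    (hu' : (⟨(X 0 : MvPolynomial (Fin 2) k) ^ n, X_pow_mem U hU 0⟩ : U) ∈ 𝔭)
    (hv' : (⟨(X 1 : MvPolynomial (Fin 2) k) ^ n, X_pow_mem U hU 1⟩ : U) ∈ 𝔭) : 𝔭 = 𝔪 := by
  have hle : 𝔪 ≤ 𝔭 := fun x hx =>
    mem_of_constantCoeff_eq_zero U hU 𝔭 hu' hv' x (constantCoeff_eq_zero_of_mem_vertex U hU 𝔪 hu hv x hx)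
  exact (Ideal.IsMaximal.eq_of_le ‹𝔪.IsMaximal› Ideal.IsPrime.ne_top' hle).symm

include hU in
/-- **(i) `S = U_𝔪` IS AN ISOLATED SINGULARITY** (`S` any localisation of `U = k[u,v]^{(n;1,q)}`, `gcd(q,n) = 1`, at its
vertex `𝔪 ∋ uⁿ, vⁿ`): for a prime `𝔮 ≠ 𝔪S` of `S`, if `S_𝔮` were not regular then `ca³(S) ⊆ 𝔮`
([IyengarTakahashi2014, Lemma 2.10 (2)]), so `uⁿ/1, vⁿ/1 ∈ 𝔮` (`uⁿ, vⁿ ∈ ca³(U)`, `ca³(U)·S ⊆ ca³(S)`), so `𝔮 ∩ U ∋ uⁿ, vⁿ`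
is the vertex and `𝔮 = 𝔪S`. [cite: IyengarTakahashi2014, Lemma 2.10 (2)] -/
theorem isIsolatedSingularity_atVertex (hq : q.Coprime n) (𝔪 : Ideal U) [𝔪.IsMaximal]
    (hu : (⟨(X 0 : MvPolynomial (Fin 2) k) ^ n, X_pow_mem U hU 0⟩ : U) ∈ 𝔪)
    (hv : (⟨(X 1 : MvPolynomial (Fin 2) k) ^ n, X_pow_mem U hU 1⟩ : U) ∈ 𝔪)
    (S : Type u) [CommRing S] [Algebra U S] [IsLocalization.AtPrime S 𝔪] [IsNoetherianRing S] [IsLocalRing S] :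
    IsIsolatedSingularity S := by
  haveI : IsNoetherianRing U := isNoetherianRing_degreeZero (k := k) (n := n) q U hU
  intro 𝔮 _ hne
  by_contra hreg
  have h3 : cohomologyAnnihilatorOfDegree S 3 ≤ 𝔮 := cohomologyAnnihilatorOfDegree_le_of_not_isRegularLocalRing 𝔮 hreg 3
  have hmap : (cohomologyAnnihilatorOfDegree U 3).map (algebraMap U S) ≤ 𝔮 :=
    (map_cohomologyAnnihilatorOfDegree_le_of_isLocalization 𝔪.primeCompl S 3).trans h3
  have hu' : (⟨(X 0 : MvPolynomial (Fin 2) k) ^ n, X_pow_mem U hU 0⟩ : U) ∈ 𝔮.comap (algebraMap U S) :=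
    Ideal.mem_comap.mpr (hmap (Ideal.mem_map_of_mem _ (X_zero_pow_mem_caAt_three U hU hq)))
  have hv' : (⟨(X 1 : MvPolynomial (Fin 2) k) ^ n, X_pow_mem U hU 1⟩ : U) ∈ 𝔮.comap (algebraMap U S) :=
    Ideal.mem_comap.mpr (hmap (Ideal.mem_map_of_mem _ (X_one_pow_mem_caAt_three U hU hq)))
  have heq : 𝔮.under U = 𝔪 := eq_vertex_of_X_pow_mem U hU 𝔪 hu hv _ hu' hv'
  apply hne
  rw [← IsLocalization.map_under 𝔪.primeCompl S 𝔮, heq, IsLocalization.AtPrime.map_eq_maximalIdeal 𝔪 S]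

/-! ## `U` is of finite type; `Ŝ` is an isolated singularity -/

include hU in
/-- **`U = k[u,v]^{(n;1,q)}` is a finitely generated `k`-algebra, and `k[u,v]` is module-finite over it** —
Artin–Tate for `k ⊆ U ⊆ k[u,v]`: `k[u,v]` is of finite type over `k` and integral over `U`
(`…LocalVertex.isIntegral_degreeZero`), hence module-finite over `U`, so `U` is of finite type over `k`.
[folklore; Atiyah–Macdonald Prop. 7.8] -/
theorem finiteType_degreeZero_and_finite :
    Algebra.FiniteType k U ∧ Module.Finite U (MvPolynomial (Fin 2) k) := by
  haveI : Algebra.IsIntegral U (MvPolynomial (Fin 2) k) := isIntegral_degreeZero U hU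
  haveI : Algebra.FiniteType U (MvPolynomial (Fin 2) k) :=
    Algebra.FiniteType.of_restrictScalars_finiteType k U (MvPolynomial (Fin 2) k)
  haveI : Module.Finite U (MvPolynomial (Fin 2) k) := Algebra.IsIntegral.finite
  exact ⟨⟨fg_of_fg_of_fg k U (MvPolynomial (Fin 2) k) Algebra.FiniteType.out Module.Finite.fg_top
    Subtype.val_injective⟩, inferInstance⟩

include hU in
/-- **(ii) `Ŝ` IS AN ISOLATED SINGULARITY** for every noetherian local localisation `S` of `U` at the vertex: `S` is an
isolated singularity (i) and a localisation of a finitely generated `k`-algebra, hence a G-ring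
(`…CompletionIsolatedTransfer.isIsolatedSingularity_adicCompletion_of_isLocalization_finiteType`).
[cite: Matsumura1987, §32 Remark 1 p. 260 and Thm. 23.7 (consequence)] -/
theorem isIsolatedSingularity_adicCompletion_atVertex (hq : q.Coprime n) (𝔪 : Ideal U) [𝔪.IsMaximal]
    (hu : (⟨(X 0 : MvPolynomial (Fin 2) k) ^ n, X_pow_mem U hU 0⟩ : U) ∈ 𝔪)
    (hv : (⟨(X 1 : MvPolynomial (Fin 2) k) ^ n, X_pow_mem U hU 1⟩ : U) ∈ 𝔪)
    (S : Type u) [CommRing S] [Algebra U S] [IsLocalization.AtPrime S 𝔪] [IsNoetherianRing S] [IsLocalRing S] :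
    IsIsolatedSingularity (AdicCompletion (maximalIdeal S) S) :=
  CompletionIsolatedTransfer.isIsolatedSingularity_adicCompletion_of_isLocalization_finiteType
    (finiteType_degreeZero_and_finite U hU).1 𝔪.primeCompl (R := S) inferInstance
    (isIsolatedSingularity_atVertex U hU hq 𝔪 hu hv S)

/-! ## `dim T = 2` from the completion -/

include hU in
/-- **(iv) `dim T = 2`** for every noetherian local `T` with `T̂ ≃+* Ŝ`: `dim T = dim T̂ = dim Ŝ = dim S = 2`.
[cite: Matsumura1987, Thm. 15.1 (consequence)] -/
theorem ringKrullDim_eq_two_of_ringEquiv_completion_vertex (𝔪 : Ideal U) [𝔪.IsMaximal]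
    (hu : (⟨(X 0 : MvPolynomial (Fin 2) k) ^ n, X_pow_mem U hU 0⟩ : U) ∈ 𝔪)
    (hv : (⟨(X 1 : MvPolynomial (Fin 2) k) ^ n, X_pow_mem U hU 1⟩ : U) ∈ 𝔪)
    (S : Type u) [CommRing S] [Algebra U S] [IsLocalization.AtPrime S 𝔪] [IsNoetherianRing S] [IsLocalRing S]
    {T : Type u} [CommRing T] [IsNoetherianRing T] [IsLocalRing T]
    (e : AdicCompletion (maximalIdeal T) T ≃+* AdicCompletion (maximalIdeal S) S) : ringKrullDim T = (2 : ℕ) := by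
  rw [← ringKrullDim_adicCompletion T, ringKrullDim_eq_of_ringEquiv e, ringKrullDim_adicCompletion S]
  exact ringKrullDim_atVertex U hU 𝔪 hu hv S

/-! ## `Sat₄` at every analytically-toric surface stage, hypothesis-minimal -/

include hU in
/-- **`ca(T) ⊆ ca⁴(T)` AT EVERY ANALYTICALLY-TORIC SURFACE STAGE — hypothesis-minimal form.**  `U = k[u,v]^{(n;1,q)}`
(`gcd(q,n) = 1`, `k` any field), `𝔪 ∋ uⁿ, vⁿ` its vertex, `S` any noetherian local localisation of `U` at `𝔪`; `T` any
noetherian local ring whose `𝔪`-adic completion is a domain, `e : T̂ ≃+* Ŝ`.  Then `ca(T) ⊆ ca⁴(T)`.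
[OURS · cell decomp-res] -/
theorem cohomologyAnnihilator_le_caAt_four_of_ringEquiv_completion_vertex' (hq : q.Coprime n) (𝔪 : Ideal U)
    [𝔪.IsMaximal] (hu : (⟨(X 0 : MvPolynomial (Fin 2) k) ^ n, X_pow_mem U hU 0⟩ : U) ∈ 𝔪)
    (hv : (⟨(X 1 : MvPolynomial (Fin 2) k) ^ n, X_pow_mem U hU 1⟩ : U) ∈ 𝔪)
    (S : Type u) [CommRing S] [Algebra U S] [IsLocalization.AtPrime S 𝔪] [IsNoetherianRing S] [IsLocalRing S]
    {T : Type u} [CommRing T] [IsNoetherianRing T] [IsLocalRing T] [IsDomain (AdicCompletion (maximalIdeal T) T)]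
    (e : AdicCompletion (maximalIdeal T) T ≃+* AdicCompletion (maximalIdeal S) S) :
    cohomologyAnnihilator T ≤ cohomologyAnnihilatorOfDegree T 4 := by
  have hisoS := isIsolatedSingularity_adicCompletion_atVertex U hU hq 𝔪 hu hv S
  have hisoT : IsIsolatedSingularity (AdicCompletion (maximalIdeal T) T) := isIsolatedSingularity_of_ringEquiv e.symm hisoS
  have hdT := ringKrullDim_eq_two_of_ringEquiv_completion_vertex U hU 𝔪 hu hv S e
  haveI : IsDomain (AdicCompletion (maximalIdeal S) S) :=
    MulEquiv.isDomain (AdicCompletion (maximalIdeal T) T) e.symm.toMulEquiv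
  obtain ⟨hlev, -⟩ := levelledSatFour_adicCompletion_atVertex U hU hq 𝔪 hu hv S hisoS
  exact cohomologyAnnihilator_le_caAt_of_levelled_of_ringEquiv_completion hdT hisoT e fun m hm => (hlev m hm).le

include hU in
/-- **`caᵐ(T) = ca(T)` for every `m ≥ 4` at every analytically-toric surface stage — hypothesis-minimal form**
(`T` noetherian local, `T̂` a domain, `e : T̂ ≃+* Ŝ`). [OURS · cell decomp-res] -/
theorem cohomologyAnnihilatorOfDegree_eq_of_ringEquiv_completion_vertex' (hq : q.Coprime n) (𝔪 : Ideal U)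
    [𝔪.IsMaximal] (hu : (⟨(X 0 : MvPolynomial (Fin 2) k) ^ n, X_pow_mem U hU 0⟩ : U) ∈ 𝔪)
    (hv : (⟨(X 1 : MvPolynomial (Fin 2) k) ^ n, X_pow_mem U hU 1⟩ : U) ∈ 𝔪)
    (S : Type u) [CommRing S] [Algebra U S] [IsLocalization.AtPrime S 𝔪] [IsNoetherianRing S] [IsLocalRing S]
    {T : Type u} [CommRing T] [IsNoetherianRing T] [IsLocalRing T] [IsDomain (AdicCompletion (maximalIdeal T) T)]
    (e : AdicCompletion (maximalIdeal T) T ≃+* AdicCompletion (maximalIdeal S) S) {m : ℕ} (hm : 4 ≤ m) :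
    cohomologyAnnihilatorOfDegree T m = cohomologyAnnihilator T :=
  le_antisymm (cohomologyAnnihilatorOfDegree_le m)
    ((cohomologyAnnihilator_le_caAt_four_of_ringEquiv_completion_vertex' U hU hq 𝔪 hu hv S e).trans
      (cohomologyAnnihilatorOfDegree_mono hm))

end Summit.ResolutionOfSingularities.ResolutionOfSingularities.Theorems.HomologicalConductor.PersistenceCyclicQuotientCompletionSatFourMinimal

end
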